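import Summits.HodgeConjecture.HodgeConjecture.Theorems.R90S6CartanShellSphere   -- ★ W7-i (p863190): `ncard_orbit_torusGen_pow_eq_ncard_sphere_stdLattice` (shell = sphere of radius `2m` about `𝒪³`)
import Literature.NumberTheory.Automorphic.UnitaryLatticeTreeValency              -- ★ T1e V4: `ncard_sphere_of_isSelfDualLattice` (spheres about a hyperspecial vertex)
import HarnessLib

/-!
# R90 · S6 «Ch. 14.1–14.5 stable trace formula» — WAVE 8 card W8-b: THE INDEX OF THE CARTAN SHELL `#(K₀ tᵐ K₀ ∕ K₀) = (q³ + 1)·q^{4m−3}`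
# (`Theorems/R90S6ShellIndexU3.lean`)

DAG r5 row E1.3.5.1.3 «SPHERES = CARTAN DOUBLE COSETS», closed-count half (W8 sheet
`R90/R90-C14-typ2/g2/S6_wave8_targets.v1.b05122f413d1b42e.lean` :59–:71, AUDIT BOX S6#W8 CLEAN ×5): for the quasi-split unitary group
`U = U(σ, J₀)(K)` in three variables over a discretely valued field `K` with the cell's unramified datum `hd : UnramifiedLocalConjDatum σ ϖ`,
its hyperspecial subgroup `K₀ = unitaryInt σ J₀`, `t = hd.torusGen = diag(ϖ, 1, ϖ⁻¹)`, and the residual binders of ★ T1e V4 (`hσO`, `σk`, `hσk`,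
`|𝓀| = q²`, `σk = Frob_q`), the INDEX of the Cartan shell — the number of left `K₀`-cosets in `K₀ tᵐ K₀`, in the orbit currency
`(MulAction.orbit K₀ (tᵐ : U ⧸ K₀)).ncard` of the W7∕W8 sheets — is `(q³ + 1)·q^{4m−3}` for `m ≥ 1` [BruhatTits1972, (4.4.4); Serre, *Trees* II.1.1;
Tits1979, §2.4; the counting road of Rogawski1990 §4.9].

PROOF = two ★ citations and exponent bookkeeping: ★ W7-i `R90.S6.ncard_orbit_torusGen_pow_eq_ncard_sphere_stdLattice` (the `K₀`-orbit of `tᵐ K₀`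
is carried bijectively onto the sphere of radius `2m` about the root `𝒪³` of the lattice tree `latticeGraph σ ϖ J₀`) and ★ T1e V4
`UnitaryLatticeTree.ncard_sphere_of_isSelfDualLattice` (`#S_n(𝒪³) = (q³+1)·q^⌊n∕2⌋·(q³)^⌊(n−1)∕2⌋`, `n ≥ 1`) at `n = 2m`:
`(q³+1)·q^m·(q³)^{m−1} = (q³+1)·q^{4m−3}`.  Kill-check `m = 1`: `q⁴ + q` (★ `card_orbit_basic_three`, ★ `ncard_sphere_two_of_isSelfDualLattice`).

Cell `hodgecm-mathlib`, crux H413 (`stmt-HodgeConjecture-24833`), route of record `HCCMUnconditional`; programme R90-TF (brief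
`director/R90-BRIEF.v2.md` 1f40d54518340a35), section S6 (base `R90-C14`, dealer R90-C14-plan (g2)), seat R90-C14-p03 (g2); card W8-b RE-DEALT BY NAME
2026-09-04T23:38:12Z; signature = sheet b05122f413d1b42e :64–:70 VERBATIM (namespace without `.Wave8`).  Lane `--kind proof --supports
stmt-HodgeConjecture-24833 --as helper`; ONE theorem, imports ★ Theorems `R90S6CartanShellSphere` + ★ Literature `UnitaryLatticeTreeValency` + HarnessLib
(Theorems may import Theorems, never `Lines/`); no definition, no instance, no notation, no named fact, no kit, no `sorry`.
HONEST LABEL: lattice-model bookkeeping over ★ carriers, count-neutral until the E1.3.9 assembly (eG-independence `hsep`, W8-c) consumes it; proves no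
printed global statement, discharges no citation; HC_CM is proved only modulo the 7 printed citations (2 remaining named inputs:
hLiu418 = stmt-HodgeConjecture-24832, h413 = stmt-HodgeConjecture-24833) until rung 0 closes.

## References
* [BruhatTits1972] F. Bruhat, J. Tits, *Groupes réductifs sur un corps local I*, Publ. Math. IHÉS 41 (1972), §10, (4.4.4).
* [Serre1980Trees] J.-P. Serre, *Trees* (1980), Ch. II §1.1.
* [Tits1979] J. Tits, *Reductive groups over local fields*, PSPM 33.1 (1979), §2.4, §3.3.3.
* [Rogawski1990] J. D. Rogawski, *Automorphic Representations of Unitary Groups in Three Variables*, Ann. of Math. Stud. 123 (1990), §4.9 pp. 55–56.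
-/

set_option autoImplicit false
-- the mandated namespace repeats the single-problem summit's segment (`HodgeConjecture.HodgeConjecture`)
set_option linter.dupNamespace false

noncomputable section

open scoped Valued WithZero Matrix MatrixGroups

open Literature.NumberTheory.Automorphic Literature.NumberTheory.Automorphic.HermitianLattice
  Literature.NumberTheory.Automorphic.UnitaryLatticeTree Literature.NumberTheory.Automorphic.CartanUnique

namespace Summit.HodgeConjecture.HodgeConjecture.R90.S6

variable {K : Type*} [Field K] [Valued K ℤᵐ⁰] {σ : K →+* K} {ϖ : K}

/-- **W8-b (M–L) THE INDEX OF THE CARTAN SHELL IS THE SPHERE COUNT**: `#(K₀ tᵐ K₀ ∕ K₀) = (q³ + 1)·q^{4m−3}` for `m ≥ 1`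
(`q² = |𝓀|`, residual Frobenius `y ↦ y^q` — the ★ V4 binders, discharged at inert places by ★ V5
`UnitaryLatticeTreeValencyInertPlace`).  Route: W8-d (the orbit of `tᵐ K₀` ↔ the self-dual sphere of radius `2m` about `L₀ = 𝒪³`,
`K₀`-equivariantly) + ★ `ncard_sphere_of_isSelfDualLattice` at radius `2m`: `(q³+1)·q^{m}·(q³)^{m−1}`.  Kill-check `m = 1`:
`q⁴ + q` = ★ `card_orbit_basic_three` (`Q² + √Q`, `Q = q²`). [cite: BruhatTits1972, (4.4.4)] [cite: Serre1980Trees, II.1.1] [cite: Tits1979, §2.4] -/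
theorem ncard_orbit_torusGen_pow_three (hd : UnramifiedLocalConjDatum σ ϖ) (hσO : ∀ x : 𝒪[K], σ x ∈ 𝒪[K]) (σk : 𝓀[K] →+* 𝓀[K])
    (hσk : ∀ x : 𝒪[K], IsLocalRing.residue 𝒪[K] ⟨σ x, hσO x⟩ = σk (IsLocalRing.residue 𝒪[K] x))
    [Fintype 𝓀[K]] {q : ℕ} (hk : Fintype.card 𝓀[K] = q ^ 2) (hfrob : ∀ y, σk y = y ^ q) {m : ℕ} (hm : 1 ≤ m) :
    (MulAction.orbit (unitaryInt σ ((StdForm.antidiagonal 3).over K))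
        ((hd.torusGen ^ m : unitaryGroupOfForm σ ((StdForm.antidiagonal 3).over K)) :
          unitaryGroupOfForm σ ((StdForm.antidiagonal 3).over K) ⧸ unitaryInt σ ((StdForm.antidiagonal 3).over K))).ncard =
      (q ^ 3 + 1) * q ^ (4 * m - 3) := by
  -- the shell is the sphere of radius `2m` about the root `𝒪³` (★ W7-i), and ★ V4 counts that sphere
  rw [ncard_orbit_torusGen_pow_eq_ncard_sphere_stdLattice hd m,
    ncard_sphere_of_isSelfDualLattice hd hσO σk hσk hk hfrob _ (isSelfDualLattice_stdLattice_three_of_v hd.vϖ)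
      (show 1 ≤ 2 * m by omega),
    Nat.mul_div_cancel_left m (by norm_num : 0 < 2), show (2 * m - 1) / 2 = m - 1 by omega, ← pow_mul, mul_assoc, ← pow_add,
    show m + 3 * (m - 1) = 4 * m - 3 by omega]

end Summit.HodgeConjecture.HodgeConjecture.R90.S6

end
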